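import Summits.ABC.IUTFork.Repair.RHOffSigmaToleranceMultAbc
import Summits.ABC.IUTFork.Conditional.AbcOfCor312SlackRecut
import HarnessLib

/-!
# R-H ROUND 2, Q1 (rows 3/4/5; seat abc-iut-rh2-xi-1): the MULTIPLICATIVE abc-tolerance of the off-Σ remainder, III — THE R14 RECUT
# of `ABC_of_offSigmaToleranceMult_of_hullRegime` (p476573): the CONE binder CUT, `hreg ↦ hregBad` (Szpiro-bad locus, p452637 VERBATIM)
# and the still weaker θ-cut `hreg ↦ hregC` (content locus of [IUTchIV] Thm. 1.10's display)

PROOF-ONLY sequel (no `def`, no new `Prop`, no instance, no notation; nothing re-typed) of this seat's `RHOffSigmaToleranceMultAbc.lean`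
(abc-iut-rh2-xi-1 gen 2, p476573) by abc-iut-rh2-xi-1 gen 3, written to abc-iut-rh-lead's RULING R14 (2026-08-26T23:54:09Z, «cone-binder recut
for EVERY R-H round-2 abc-end; one PROOF-ONLY recut per author») and its 00:14:47Z (4) tag «p476573 … its abc end carries the R14 tag like the
rest». TAKES NO SIDE on [IUTchIII] Cor. 3.12 or on any author. Rung LADDER-ABC:A2.RESCUE.H.

WHY. All three §2 theorems of p476573 (`thm110Legendre_` / `ThetaPartII_` / `ABC_of_offSigmaToleranceMult_of_hullRegime`) carry the BLANKET
cone binder `hreg` («at EVERY admissible `(P, l)` and every genuine datum `T` off the slot-constant regime, `T.HullEstimateOf (B_III(P,l))`»),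
which is KERNEL-REFUTED as typed (abc-iut-s2-p5's `Conditional.not_hreg_v4`: the QuadWitness family). Hence they are COMPOSITION RECORDS,
VACUOUS AS TYPED in [CONE] (R14 (1); rh-ref-3's binding caveat 2026-08-26T22:55:30Z). R14 (2): the no-loss ARITHMETIC — p469145
`gap_le_of_cor312UpTo`, p476573 §1 `logQAvoid_mul_le_of_tolerance` (the dilated squeeze at the datum), p476254 `display_of_squeezeIII_mult'`
(Step (viii) with the exact coefficient `(l+1)/24 − 1/(2l)` absorbing the dilation `(1 − κ)`, `κ ≤ 1/(2l)`) — does not depend on which cone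
binder supplies the hull estimate and is REUSED BY NAME. R14 (3): recut on `hregBad` VERBATIM from abc-iut-C-cert-2's
`Conditional.abc_of_SH_orNum_K_szpiroBad_hregBad` (p452637), through the θ-cut exactly as abc-iut-rh2-q2-cond gen 2 recut the `κ = 0` door
(`Cor312Slack.ABC_of_cor312Slack_szpiroBad_hregBad`, `Conditional/AbcOfCor312SlackRecut.lean`), whose one-datum junction
`Cor312Slack.hullEstimateOf_BIII_of_offRegime` (ON the slot-constant regime the hull estimate is abc-iut-S3's PINNED theorem
`PointDict.hullEstimateOf_BIII_pinned` over abc-iut-S1's `ThetaPartII.stub_R4`; OFF it the hypothesis) is imported, not re-proved.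

WHAT IS TYPED (notation: `Tol(P,l) = ((l+1)/4)·5·d*·l`, `d* = 2^{12}·3^3·5·d_mod`; `OffSigmaTolerance κ A T B := B ≤ κ·T.gap + A` (p469145);
`B(P,l,T)` = the off-Σ deficit an `S_H|Σ` volume computation leaves, ASSUMPTION LABEL; content guard
«`6·(1 + 20·d_mod/l)·(log-diff + log-cond) + 120·d*_mod·l < log q^{∤{2,l}}(λ)`»; Szpiro-bad guard = the antecedent of abc-iut-c312-d1's
`Cor22.forall_cor312Of_of_szpiroBad` «`(l+5)/4 < d_mod ∨ (6l(l+5−4d_mod)/((l+4)(l−3)))·(log-diff + (1−1/l)·log-cond) + (6l(l+5)/((l+4)(l−3)))·log π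
< log q^{∤{2,l}}(λ)`», inserted after (P6) exactly as in p452637):
* §1 THE θ-CUT: `thm110Legendre_of_offSigmaToleranceMult_content_hregC`, **`ABC_of_offSigmaToleranceMult_content_hregC`** — [NUMΣ-upTo-C]
  «Cor. 3.12 up to `B`» `T.negAbsLogQ − B(P,l,T) ≤ T.negLogTheta` demanded ONLY at the genuine data of admissible `(P, l)` ON THE CONTENT LOCUS ·
  [TOL-mult-C] `OffSigmaTolerance (1/(2l)) Tol T B` there · [CONE-C] `hregC` VERBATIM (abc-iut-C-cert-1's binder, = q2-cond's recut text) ⟹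
  `Cor22.Thm110Legendre` with print's constants ⟹ `ABC`. Pointwise (`ThetaPartIIDisplay.thm110Legendre_of_pointwise`): OFF the locus the display
  holds by its own additive constant (abc-iut-C-cert-1's `display_of_not_content`, `η > 0` from `IsEtaPrm`) — NOTHING of any class is assumed at
  any admissible `(P, l)` with `log q^{∤{2,l}}(λ) ≤ 120·d*_mod·l`; ON it a genuine datum exists (abc-iut-L5-t7 `ThetaPartII.stub_thetaData`), the
  junction gives the hull estimate from `hregC`, `logQAvoid_mul_le_of_tolerance` the dilated squeeze, `display_of_squeezeIII_mult'` the display.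
* §2 THE R14 RECUT: **`ABC_of_offSigmaToleranceMult_szpiroBad_hregBad`** — the three binders of p476573 each with the Szpiro-bad antecedent
  inserted at the same place, `hregBad` = p452637 :`hregBad` VERBATIM; a λ-term over §1 (abc-iut-C-cert-1's `szpiroBad_of_content`: the content
  guard implies the Szpiro-bad guard, so content-cut binders are WEAKER-OR-EQUAL); and **`ABC_of_offSigmaToleranceMult_hregBad`** — p476573's
  `ABC_of_offSigmaToleranceMult_of_hullRegime` with `h312B` / `hTol` AS THEY WERE and ONLY `hreg ↦ hregBad` (guard-only delta: the minimal
  recut). Binder by binder every theorem here is STRONGER-OR-EQUAL than p476573's (`hreg ⟹ hregBad ⟹ hregC` by premise drop,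
  abc-iut-s2-p2's `ThetaPartII.hullRegimeBad_of_hullRegime`): p476573's door is `ABC_of_offSigmaToleranceMult_hregBad B h312B hTol
  (fun P hP l hl h5 hcore hP2 hP5 h6 _ => hreg P hP l hl h5 hcore hP2 hP5 h6)` — checked on the farm (rc 0) and deliberately NOT re-landed
  (the gate's `dedup.landed` forbids restating p476573's statement).

READING (numbers unchanged, R14 (2)/(5)). The tolerated off-Σ remainder of this door stays `B ≤ T.gap/(2l) + Tol(P,l)` in the currency of
`−|log(Θ)|`, `T.gap/(2l) = ((l+1)/(48l) − 1/(4l²))·log q^{∤{2,l}}(λ)` on the `λ`-line (p476573 `gap_div_two_l_eq`) — the share that grows with the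
height; the conclusion is still Thm. 1.10's display with PRINT'S constants (no-loss class, ceiling `κ ≤ 1/(2l)`; `κ = c/l`, `c > 0.62` at `l = 7`
is NOT absorbed — p476254's docstring). What moves is the kernel object carrying the sentence: the CONE factor is now asked only at Szpiro-bad
(resp. content-locus) admissible points, where `hregBad` / `hregC` are neither instantiated nor refuted as typed (`not_hreg_v4` does not
elaborate against the guarded text). RELATION (honest, as in p476573): for `ABC` the WINDOWED certificate of abc-iut-rh2-q2-cond (p473109,
recut in `AbcOfCor312SlackRecutTolerances.lean`) has weaker tolerance hypotheses inside its window; the present door is the window-free form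
through `Cor22.Thm110Legendre` itself. HONEST FRAMING: locates / conditionally verifies; nothing here asserts that abc is proved or refuted,
or that [IUTchIII] Cor. 3.12 / Thm. 3.11 or [IUTchIV] Thm. 1.10 holds or fails at any datum, or takes a side on any author (Mochizuki /
Scholze–Stix / Joshi / Dupuy–Hilado); `h312…` / `hTol…` / `hregBad` / `hregC` are ASSUMPTION LABELS, never asserted; «`ABC` follows from these
hypotheses AS TYPED», nothing more; CONDITIONAL; typed ≠ proved; instantiated ≠ endorsed; refuted-as-typed ≠ refuted-in-print.
[cite: Mochizuki2012, IUTchIV Thm. 1.10 pp. 22–31 (Step (v) pp. 27–28, Step (viii) pp. 30–31); Cor. 2.2 (ii)–(iii) pp. 41–48 (p. 46)]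
[cite: Mochizuki2012, IUTchIII Cor. 3.12 pp. 173–174, Step (xi-f) p. 184] [claim: Mochizuki2012, status: disputed]
Axioms: standard.
-/

noncomputable section

namespace Summit.ABC.IUTFork.Repair.RH.OffSigma

open Literature.IUT.LogVolume Literature.IUT.HodgeTheaters Literature.NumberTheory.DiophantineGeometry.GenEll
open Summit.ABC.ABC.Theorems Summit.ABC.IUTFork.Conditional NumberField IsDedekindDomain

/-! ## §1 The θ-cut: all three binders of p476573 demanded only on the content locus of the display -/

/-- **`Cor22.Thm110Legendre` (print's constants) from «Cor. 3.12 up to `B`» under the MULTIPLICATIVE tolerance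
`OffSigmaTolerance (1/(2l)) Tol T B` and the cone binder, ALL THREE CUT TO THE CONTENT LOCUS of [IUTchIV] Thm. 1.10's display**
(`6·(1 + 20·d_mod/l)·(log-diff + log-cond) + 120·d*_mod·l < log q^{∤{2,l}}(λ)`): pointwise (`ThetaPartIIDisplay.thm110Legendre_of_pointwise`);
off the locus the display is free (abc-iut-C-cert-1's `display_of_not_content`, `η > 0` from `IsEtaPrm`); on it a genuine datum exists
(abc-iut-L5-t7 `ThetaPartII.stub_thetaData`), abc-iut-rh2-q2-cond's junction `Cor312Slack.hullEstimateOf_BIII_of_offRegime` gives the hull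
estimate from `hregC` (pinned theorem on the slot-constant regime), p476573's `logQAvoid_mul_le_of_tolerance` the dilated squeeze
`(1 − 1/(2l))·gap ≤ B_III + Tol + ((l+5)/4)·log π` and p476254's `display_of_squeezeIII_mult'` the display. `hregC` is abc-iut-C-cert-1's binder
(`ABC_of_cor312C_of_hullRegimeC`, = q2-cond's `thm110Legendre_of_cor312Slack_content_hregC` :`hregC`) VERBATIM. CONDITIONAL on `h312BC`,
`hTolC`, `hregC`; no side taken. [cite: Mochizuki2012, IUTchIV Thm. 1.10 pp. 22–31; Cor. 2.2 (ii) proof p. 46] [claim: Mochizuki2012, status: disputed] -/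
theorem thm110Legendre_of_offSigmaToleranceMult_content_hregC
    (B : ∀ (P : NFPoint) (l : ℕ), Cor22.ThetaVolumeDatumAt P l → ℝ)
    (h312BC : ∀ P : NFPoint, P ∈ UP → ∀ l : ℕ, l.Prime → 5 ≤ l →
      Cor22.AdmitsCore P → Cor22.CondP2 P l → Cor22.CondP5 P l → Cor22.CondP6 P l →
      6 * ((1 + 20 * (Cor22.dmod P : ℝ) / l) * (P.logDiff + Cor22.logCondAvoid P {2, l}))
          + 120 * (2 ^ 12 * 3 ^ 3 * 5 * (Cor22.dmod P : ℝ) * l) < Cor22.logQAvoid P {2, l} →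
      ∀ T : Cor22.ThetaVolumeDatumAt P l, T.negAbsLogQ - B P l T ≤ T.negLogTheta)
    (hTolC : ∀ P : NFPoint, P ∈ UP → ∀ l : ℕ, l.Prime → 5 ≤ l →
      Cor22.AdmitsCore P → Cor22.CondP2 P l → Cor22.CondP5 P l → Cor22.CondP6 P l →
      6 * ((1 + 20 * (Cor22.dmod P : ℝ) / l) * (P.logDiff + Cor22.logCondAvoid P {2, l}))
          + 120 * (2 ^ 12 * 3 ^ 3 * 5 * (Cor22.dmod P : ℝ) * l) < Cor22.logQAvoid P {2, l} →
      ∀ T : Cor22.ThetaVolumeDatumAt P l,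
        OffSigmaTolerance (1 / (2 * (l : ℝ))) (((l : ℝ) + 1) / 4 * (5 * ((((2 ^ 12 * 3 ^ 3 * 5 * Cor22.dmod P : ℕ) : ℝ)) * l)))
          T (B P l T))
    (hregC : ∀ P : NFPoint, P ∈ UP → ∀ l : ℕ, l.Prime → 5 ≤ l →
      Cor22.AdmitsCore P → Cor22.CondP2 P l → Cor22.CondP5 P l → Cor22.CondP6 P l →
      6 * ((1 + 20 * (Cor22.dmod P : ℝ) / l) * (P.logDiff + Cor22.logCondAvoid P {2, l}))
          + 120 * (2 ^ 12 * 3 ^ 3 * 5 * (Cor22.dmod P : ℝ) * l) < Cor22.logQAvoid P {2, l} →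
      ∀ T : Cor22.ThetaVolumeDatumAt P l,
        (letI := T.instFieldF; letI := T.instNumberFieldF; letI := T.instAlgebraF; letI := T.instFieldK
         letI := T.instNumberFieldK; letI := T.instAlgebraK; letI := T.instFieldFbar; letI := T.instAlgebraFbar
         letI := T.instAlgebraKFbar; letI := T.instIsElliptic
         ¬ (∀ p ∈ T.I.supportPrimes, ∀ v w : placesOver (fieldOfModuli T.E) p,
            (Summit.ABC.IUTFork.DHData.ofInput T.I).logQloc p v = (Summit.ABC.IUTFork.DHData.ofInput T.I).logQloc p w)) →
        T.HullEstimateOf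
          (((l : ℝ) + 1) / 4 *
            ((1 + 12 * (Cor22.dmod P : ℝ) / l) * (P.logDiff + Cor22.logCondAvoid P {2, l})
              + 2 * Real.log l + 52
              + 20 / 3 * Real.log (((2 ^ 12 * 3 ^ 3 * 5 * Cor22.dmod P : ℕ) : ℝ) * (l : ℝ))
                * (Nat.primeCounting (2 ^ 12 * 3 ^ 3 * 5 * Cor22.dmod P * l) : ℝ)))) :
    Cor22.Thm110Legendre :=
  ThetaPartIIDisplay.thm110Legendre_of_pointwise fun η hη P hP l hl h5 hne hcore hP2 hP5 h6 => by
    by_cases hct : 6 * ((1 + 20 * (Cor22.dmod P : ℝ) / l) * (P.logDiff + Cor22.logCondAvoid P {2, l}))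
          + 120 * (2 ^ 12 * 3 ^ 3 * 5 * (Cor22.dmod P : ℝ) * l) < Cor22.logQAvoid P {2, l}
    swap
    · -- OFF the content locus: the display holds by its own constant — NOTHING assumed
      exact display_of_not_content hη.1 hct
    obtain ⟨T⟩ := ThetaPartII.stub_thetaData P hP l hl h5 hcore hP2 hP5 h6
    have hsq := logQAvoid_mul_le_of_tolerance T hP.1 (hTolC P hP l hl h5 hcore hP2 hP5 h6 hct T)
      (h312BC P hP l hl h5 hcore hP2 hP5 h6 hct T)
      (Cor312Slack.hullEstimateOf_BIII_of_offRegime hP hl h5 hcore hP2 hP5 h6 T (hregC P hP l hl h5 hcore hP2 hP5 h6 hct T))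
    exact display_of_squeezeIII_mult' hl h5 hne hη le_rfl le_rfl hsq

/-- **`abc` FROM «COR. 3.12 UP TO `B`» UNDER THE MULTIPLICATIVE TOLERANCE, θ-CUT**: [NUMΣ-upTo-C] `−|log(q)| − B(P,l,T) ≤ −|log(Θ)|` at every
genuine Θ-volume datum of every admissible `(P, l)` ON THE CONTENT LOCUS of the display (ASSUMPTION LABEL; what an `S_H|Σ` volume computation
delivers, `B` = the off-Σ deficit) · [TOL-mult-C] `B(P,l,T) ≤ T.gap/(2l) + ((l+1)/4)·5·d*_mod·l` there (`OffSigmaTolerance (1/(2l)) Tol T B`) ·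
[CONE-C] `hregC` (abc-iut-C-cert-1's binder VERBATIM) ⟹ `ABC` with NO constant of the chain of record changed
(`Cor22.exists_partII_of_thm110Legendre`, `Cor22.fullGaloisImage_holds`, route theorem `closes`, `genEllTwo_holds`, `JInvWlog_proof` — all
PROVED). At every admissible `(P, l)` with `log q^{∤{2,l}}(λ) ≤ 120·d*_mod·l` NOTHING is assumed. CONDITIONAL; nothing is asserted about the
hypotheses; no side taken. [cite: Mochizuki2012, IUTchIV Cor. 2.2–2.3 pp. 41–55] [cite: Mochizuki2012, IUTchIII Cor. 3.12 p. 174]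
[claim: Mochizuki2012, status: disputed] -/
theorem ABC_of_offSigmaToleranceMult_content_hregC
    (B : ∀ (P : NFPoint) (l : ℕ), Cor22.ThetaVolumeDatumAt P l → ℝ)
    (h312BC : ∀ P : NFPoint, P ∈ UP → ∀ l : ℕ, l.Prime → 5 ≤ l →
      Cor22.AdmitsCore P → Cor22.CondP2 P l → Cor22.CondP5 P l → Cor22.CondP6 P l →
      6 * ((1 + 20 * (Cor22.dmod P : ℝ) / l) * (P.logDiff + Cor22.logCondAvoid P {2, l}))
          + 120 * (2 ^ 12 * 3 ^ 3 * 5 * (Cor22.dmod P : ℝ) * l) < Cor22.logQAvoid P {2, l} →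
      ∀ T : Cor22.ThetaVolumeDatumAt P l, T.negAbsLogQ - B P l T ≤ T.negLogTheta)
    (hTolC : ∀ P : NFPoint, P ∈ UP → ∀ l : ℕ, l.Prime → 5 ≤ l →
      Cor22.AdmitsCore P → Cor22.CondP2 P l → Cor22.CondP5 P l → Cor22.CondP6 P l →
      6 * ((1 + 20 * (Cor22.dmod P : ℝ) / l) * (P.logDiff + Cor22.logCondAvoid P {2, l}))
          + 120 * (2 ^ 12 * 3 ^ 3 * 5 * (Cor22.dmod P : ℝ) * l) < Cor22.logQAvoid P {2, l} →
      ∀ T : Cor22.ThetaVolumeDatumAt P l,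
        OffSigmaTolerance (1 / (2 * (l : ℝ))) (((l : ℝ) + 1) / 4 * (5 * ((((2 ^ 12 * 3 ^ 3 * 5 * Cor22.dmod P : ℕ) : ℝ)) * l)))
          T (B P l T))
    (hregC : ∀ P : NFPoint, P ∈ UP → ∀ l : ℕ, l.Prime → 5 ≤ l →
      Cor22.AdmitsCore P → Cor22.CondP2 P l → Cor22.CondP5 P l → Cor22.CondP6 P l →
      6 * ((1 + 20 * (Cor22.dmod P : ℝ) / l) * (P.logDiff + Cor22.logCondAvoid P {2, l}))
          + 120 * (2 ^ 12 * 3 ^ 3 * 5 * (Cor22.dmod P : ℝ) * l) < Cor22.logQAvoid P {2, l} →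
      ∀ T : Cor22.ThetaVolumeDatumAt P l,
        (letI := T.instFieldF; letI := T.instNumberFieldF; letI := T.instAlgebraF; letI := T.instFieldK
         letI := T.instNumberFieldK; letI := T.instAlgebraK; letI := T.instFieldFbar; letI := T.instAlgebraFbar
         letI := T.instAlgebraKFbar; letI := T.instIsElliptic
         ¬ (∀ p ∈ T.I.supportPrimes, ∀ v w : placesOver (fieldOfModuli T.E) p,
            (Summit.ABC.IUTFork.DHData.ofInput T.I).logQloc p v = (Summit.ABC.IUTFork.DHData.ofInput T.I).logQloc p w)) →
        T.HullEstimateOf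
          (((l : ℝ) + 1) / 4 *
            ((1 + 12 * (Cor22.dmod P : ℝ) / l) * (P.logDiff + Cor22.logCondAvoid P {2, l})
              + 2 * Real.log l + 52
              + 20 / 3 * Real.log (((2 ^ 12 * 3 ^ 3 * 5 * Cor22.dmod P : ℕ) : ℝ) * (l : ℝ))
                * (Nat.primeCounting (2 ^ 12 * 3 ^ 3 * 5 * Cor22.dmod P * l) : ℝ)))) :
    _root_.ABC := by
  refine Summit.ABC.ABC.Theses.IUTThetaPilot.closes ?_ Summit.ABC.ABC.Theorems.genEllTwo_holds
    Summit.ABC.ABC.Theorems.JInvWlog_proof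
  unfold Summit.ABC.ABC.Theses.IUTThetaPilot.ThetaPartII
  exact Cor22.exists_partII_of_thm110Legendre (thm110Legendre_of_offSigmaToleranceMult_content_hregC B h312BC hTolC hregC)
    Cor22.fullGaloisImage_holds

/-! ## §2 The R14 recut: the binders of p476573 cut to the SZPIRO-BAD locus, `hregBad` VERBATIM from p452637 -/

/-- **`ABC_of_offSigmaToleranceMult_szpiroBad_hregBad`** (rh-lead RULING R14 (3), the recut of the T-mult door) — `abc` FROM «COR. 3.12 UP TO
`B`» UNDER THE MULTIPLICATIVE TOLERANCE, with ALL THREE binders of p476573's `ABC_of_offSigmaToleranceMult_of_hullRegime` CUT TO THE SZPIRO-BAD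
admissible `(P, l)` («`(l+5)/4 < d_mod ∨ (6l(l+5−4d_mod)/((l+4)(l−3)))·(log-diff + (1−1/l)·log-cond) + (6l(l+5)/((l+4)(l−3)))·log π < log q^{∤{2,l}}(λ)`»,
the antecedent of abc-iut-c312-d1's `Cor22.forall_cor312Of_of_szpiroBad`, inserted after (P6) exactly as in p452637): [NUMΣ-upTo-bad]
`−|log(q)| − B(P,l,T) ≤ −|log(Θ)|` at the genuine data there · [TOL-mult-bad] `OffSigmaTolerance (1/(2l)) (((l+1)/4)·5·d*_mod·l) T B` there ·
[CONE-bad] `hregBad` = abc-iut-C-cert-2's `Conditional.abc_of_SH_orNum_K_szpiroBad_hregBad` :`hregBad` VERBATIM ⟹ `ABC`, no constant of the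
chain of record changed. Explicit 3 = NUMΣ-upTo(Szpiro-bad) · TOL-mult(Szpiro-bad) · CONE(Szpiro-bad); at every Szpiro-GOOD admissible `(P, l)`
NOTHING is assumed. A λ-term over the θ-cut `ABC_of_offSigmaToleranceMult_content_hregC` (the content guard implies the Szpiro-bad guard:
abc-iut-C-cert-1's `szpiroBad_of_content`). `hregBad` is neither proved nor refuted as typed (`Conditional.not_hreg_v4` refutes only the
blanket `hreg`). CONDITIONAL; nothing is asserted about the hypotheses; no side taken.
[cite: Mochizuki2012, IUTchIV Thm. 1.10 pp. 22–31; Cor. 2.2 (ii)–(iii) pp. 43–47] [cite: Mochizuki2012, IUTchIII Cor. 3.12 p. 174]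
[claim: Mochizuki2012, status: disputed] -/
theorem ABC_of_offSigmaToleranceMult_szpiroBad_hregBad
    (B : ∀ (P : NFPoint) (l : ℕ), Cor22.ThetaVolumeDatumAt P l → ℝ)
    -- [NUMΣ-upTo, Szpiro-bad] «Cor. 3.12 up to `B`» at the genuine data, demanded ONLY at SZPIRO-BAD admissible `(P, l)`
    (h312BBad : ∀ P : NFPoint, P ∈ UP → ∀ l : ℕ, l.Prime → 5 ≤ l →
      Cor22.AdmitsCore P → Cor22.CondP2 P l → Cor22.CondP5 P l → Cor22.CondP6 P l →
      (((l : ℝ) + 5) / 4 < (Cor22.dmod P : ℝ) ∨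
        6 * l * (((l : ℝ) + 5) - 4 * Cor22.dmod P) / (((l : ℝ) + 4) * ((l : ℝ) - 3))
            * (P.logDiff + (1 - 1 / (l : ℝ)) * Cor22.logCondAvoid P {2, l})
          + 6 * l * ((l : ℝ) + 5) / (((l : ℝ) + 4) * ((l : ℝ) - 3)) * Real.log Real.pi < Cor22.logQAvoid P {2, l}) →
      ∀ T : Cor22.ThetaVolumeDatumAt P l, T.negAbsLogQ - B P l T ≤ T.negLogTheta)
    -- [TOL-mult, Szpiro-bad] `B ≤ T.gap/(2l) + Tol(P,l)`, demanded ONLY there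
    (hTolBad : ∀ P : NFPoint, P ∈ UP → ∀ l : ℕ, l.Prime → 5 ≤ l →
      Cor22.AdmitsCore P → Cor22.CondP2 P l → Cor22.CondP5 P l → Cor22.CondP6 P l →
      (((l : ℝ) + 5) / 4 < (Cor22.dmod P : ℝ) ∨
        6 * l * (((l : ℝ) + 5) - 4 * Cor22.dmod P) / (((l : ℝ) + 4) * ((l : ℝ) - 3))
            * (P.logDiff + (1 - 1 / (l : ℝ)) * Cor22.logCondAvoid P {2, l})
          + 6 * l * ((l : ℝ) + 5) / (((l : ℝ) + 4) * ((l : ℝ) - 3)) * Real.log Real.pi < Cor22.logQAvoid P {2, l}) →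
      ∀ T : Cor22.ThetaVolumeDatumAt P l,
        OffSigmaTolerance (1 / (2 * (l : ℝ))) (((l : ℝ) + 1) / 4 * (5 * ((((2 ^ 12 * 3 ^ 3 * 5 * Cor22.dmod P : ℕ) : ℝ)) * l)))
          T (B P l T))
    -- [CONE, Szpiro-bad] the off-regime hull estimate with print's constant `B_III(P,l)`, demanded ONLY there (p452637 :`hregBad` VERBATIM)
    (hregBad : ∀ P : NFPoint, P ∈ UP → ∀ l : ℕ, l.Prime → 5 ≤ l →
      Cor22.AdmitsCore P → Cor22.CondP2 P l → Cor22.CondP5 P l → Cor22.CondP6 P l →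
      (((l : ℝ) + 5) / 4 < (Cor22.dmod P : ℝ) ∨
        6 * l * (((l : ℝ) + 5) - 4 * Cor22.dmod P) / (((l : ℝ) + 4) * ((l : ℝ) - 3))
            * (P.logDiff + (1 - 1 / (l : ℝ)) * Cor22.logCondAvoid P {2, l})
          + 6 * l * ((l : ℝ) + 5) / (((l : ℝ) + 4) * ((l : ℝ) - 3)) * Real.log Real.pi < Cor22.logQAvoid P {2, l}) →
      ∀ T : Cor22.ThetaVolumeDatumAt P l,
        (letI := T.instFieldF; letI := T.instNumberFieldF; letI := T.instAlgebraF; letI := T.instFieldK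
         letI := T.instNumberFieldK; letI := T.instAlgebraK; letI := T.instFieldFbar; letI := T.instAlgebraFbar
         letI := T.instAlgebraKFbar; letI := T.instIsElliptic
         ¬ (∀ p ∈ T.I.supportPrimes, ∀ v w : placesOver (fieldOfModuli T.E) p,
            (Summit.ABC.IUTFork.DHData.ofInput T.I).logQloc p v = (Summit.ABC.IUTFork.DHData.ofInput T.I).logQloc p w)) →
        T.HullEstimateOf
          (((l : ℝ) + 1) / 4 *
            ((1 + 12 * (Cor22.dmod P : ℝ) / l) * (P.logDiff + Cor22.logCondAvoid P {2, l})
              + 2 * Real.log l + 52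
              + 20 / 3 * Real.log (((2 ^ 12 * 3 ^ 3 * 5 * Cor22.dmod P : ℕ) : ℝ) * (l : ℝ))
                * (Nat.primeCounting (2 ^ 12 * 3 ^ 3 * 5 * Cor22.dmod P * l) : ℝ))))
    : _root_.ABC :=
  ABC_of_offSigmaToleranceMult_content_hregC B
    (fun P hP l hl h5 hcore hP2 hP5 h6 hct => h312BBad P hP l hl h5 hcore hP2 hP5 h6 (szpiroBad_of_content h5 hct))
    (fun P hP l hl h5 hcore hP2 hP5 h6 hct => hTolBad P hP l hl h5 hcore hP2 hP5 h6 (szpiroBad_of_content h5 hct))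
    (fun P hP l hl h5 hcore hP2 hP5 h6 hct => hregBad P hP l hl h5 hcore hP2 hP5 h6 (szpiroBad_of_content h5 hct))

/-- **`ABC_of_offSigmaToleranceMult_hregBad`** — THE MINIMAL RECUT (guard-only delta): p476573's `ABC_of_offSigmaToleranceMult_of_hullRegime`
with its [NUMΣ-upTo] `h312B` and [TOL-mult] `hTol` binders AS THEY WERE (at every admissible `(P, l)`) and ONLY the cone binder replaced,
`hreg ↦ hregBad` (p452637 VERBATIM). Premise drop over `ABC_of_offSigmaToleranceMult_szpiroBad_hregBad`. CONDITIONAL; nothing is asserted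
about the hypotheses; no side taken. [cite: Mochizuki2012, IUTchIV Cor. 2.2–2.3 pp. 41–55] [cite: Mochizuki2012, IUTchIII Cor. 3.12 p. 174]
[claim: Mochizuki2012, status: disputed] -/
theorem ABC_of_offSigmaToleranceMult_hregBad
    (B : ∀ (P : NFPoint) (l : ℕ), Cor22.ThetaVolumeDatumAt P l → ℝ)
    (h312B : ∀ P : NFPoint, P ∈ UP → ∀ l : ℕ, l.Prime → 5 ≤ l →
      Cor22.AdmitsCore P → Cor22.CondP2 P l → Cor22.CondP5 P l → Cor22.CondP6 P l →
      ∀ T : Cor22.ThetaVolumeDatumAt P l, T.negAbsLogQ - B P l T ≤ T.negLogTheta)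
    (hTol : ∀ P : NFPoint, P ∈ UP → ∀ l : ℕ, l.Prime → 5 ≤ l →
      Cor22.AdmitsCore P → Cor22.CondP2 P l → Cor22.CondP5 P l → Cor22.CondP6 P l →
      ∀ T : Cor22.ThetaVolumeDatumAt P l,
        OffSigmaTolerance (1 / (2 * (l : ℝ))) (((l : ℝ) + 1) / 4 * (5 * ((((2 ^ 12 * 3 ^ 3 * 5 * Cor22.dmod P : ℕ) : ℝ)) * l)))
          T (B P l T))
    (hregBad : ∀ P : NFPoint, P ∈ UP → ∀ l : ℕ, l.Prime → 5 ≤ l →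
      Cor22.AdmitsCore P → Cor22.CondP2 P l → Cor22.CondP5 P l → Cor22.CondP6 P l →
      (((l : ℝ) + 5) / 4 < (Cor22.dmod P : ℝ) ∨
        6 * l * (((l : ℝ) + 5) - 4 * Cor22.dmod P) / (((l : ℝ) + 4) * ((l : ℝ) - 3))
            * (P.logDiff + (1 - 1 / (l : ℝ)) * Cor22.logCondAvoid P {2, l})
          + 6 * l * ((l : ℝ) + 5) / (((l : ℝ) + 4) * ((l : ℝ) - 3)) * Real.log Real.pi < Cor22.logQAvoid P {2, l}) →
      ∀ T : Cor22.ThetaVolumeDatumAt P l,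
        (letI := T.instFieldF; letI := T.instNumberFieldF; letI := T.instAlgebraF; letI := T.instFieldK
         letI := T.instNumberFieldK; letI := T.instAlgebraK; letI := T.instFieldFbar; letI := T.instAlgebraFbar
         letI := T.instAlgebraKFbar; letI := T.instIsElliptic
         ¬ (∀ p ∈ T.I.supportPrimes, ∀ v w : placesOver (fieldOfModuli T.E) p,
            (Summit.ABC.IUTFork.DHData.ofInput T.I).logQloc p v = (Summit.ABC.IUTFork.DHData.ofInput T.I).logQloc p w)) →
        T.HullEstimateOf
          (((l : ℝ) + 1) / 4 *
            ((1 + 12 * (Cor22.dmod P : ℝ) / l) * (P.logDiff + Cor22.logCondAvoid P {2, l})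
              + 2 * Real.log l + 52
              + 20 / 3 * Real.log (((2 ^ 12 * 3 ^ 3 * 5 * Cor22.dmod P : ℕ) : ℝ) * (l : ℝ))
                * (Nat.primeCounting (2 ^ 12 * 3 ^ 3 * 5 * Cor22.dmod P * l) : ℝ))))
    : _root_.ABC :=
  ABC_of_offSigmaToleranceMult_szpiroBad_hregBad B (fun P hP l hl h5 hcore hP2 hP5 h6 _ => h312B P hP l hl h5 hcore hP2 hP5 h6)
    (fun P hP l hl h5 hcore hP2 hP5 h6 _ => hTol P hP l hl h5 hcore hP2 hP5 h6) hregBad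

end Summit.ABC.IUTFork.Repair.RH.OffSigma

end
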